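import Mathlib.Tactic.IntervalCases
import Summits.CriticalPhenomena.PercolationContinuityZ3.Theorems.PercNearOneGluingNoHeavyLowerTailSahiSlotPatternBranching
import Summits.CriticalPhenomena.PercolationContinuityZ3.Theorems.PercNearOneGluingNoHeavyLowerTailSahiSlotPatternThree
import Summits.CriticalPhenomena.PercolationContinuityZ3.Theorems.PercNearOneGluingNoHeavyLowerTailSahiSlotPatternTwo
import Summits.CriticalPhenomena.PercolationContinuityZ3.Theorems.PercNearOneGluingNoHeavyLowerTailSahiSlotPatternCopyKernel

/-!
# The first open cell `(3,4)` is reduced to ANTICHAINS of four up-sets of `[4]^3`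

Support file (lane `prim-masterthm-p3`, generation 18; `--supports stmt-CriticalPhenomena-4575`).  Pure proofs, no definitions, no
`sorry`; COMPUTATIONAL closure (through `slotPatternPos_three_three`, cell `prim-sahi`'s `native_decide` certificate of `[3]^3`).

The lower cells `(3,1), (3,2), (3,3)` of the slot table are theorems of the tree, so the conditional results of
`…SahiSlotPatternBranching` become unconditional at `(d, n+2) = (3, 4)`:
* `patternForm_three_four_nonneg_of_comparable`: Lieb–Sahi's coefficientwise `(3,4)` inequality holds for EVERY quadruple of up-sets of
  `[4]^3` containing a comparable pair `U_i ⊆ U_j` (`i ≠ j`);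
* `patternForm_three_four_one_cons_nonneg`: and for every quadruple containing the whole cube (branching);
* **`slotPatternPos_three_four_of_antichains`**: `SlotPatternPos 3 4` (= `PatternPosN 4 3` = Lieb–Sahi at `(k,n) = (3,4)` coefficientwise,
  the first open cell) follows from its restriction to PAIRWISE INCOMPARABLE quadruples of up-sets.
So the open problem lives on antichains of length `4` in the lattice of up-sets of `[4]^3`; sharper, on the quadruples in which NO member
contains the intersection of the other three (`slotPatternPos_three_four_of_noncontaining`). [this work]
-/

namespace Summit.CriticalPhenomena.PercolationContinuityZ3.Theorems

open Finset Function
open Literature.Combinatorics.Sahi2008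

namespace SahiSlot

/-- The lower cells at `(3,4)`: `SlotPatternPos 3 k` for `1 ≤ k ≤ 3`. [this work] -/
private theorem slotPatternPos_three_low (k : ℕ) (hk1 : 1 ≤ k) (hk3 : k ≤ 3) : SlotPatternPos 3 k := by
  interval_cases k
  · exact slotPatternPos_one 3
  · exact slotPatternPos_two 3
  · exact slotPatternPos_three_three

/-- **`(3,4)` for quadruples with a comparable pair.** [this work] -/
theorem patternForm_three_four_nonneg_of_comparable (W : Fin 4 → Finset (Q 3 4)) (hW : ∀ j, IsUpperSet (W j : Set (Q 3 4)))
    {i j : Fin 4} (hij : i ≠ j) (hWij : W i ⊆ W j) : 0 ≤ patternForm 3 4 (fun k => setInd (W k)) :=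
  patternForm_setInd_nonneg_of_comparable (d := 3) (n := 2) (fun k hk1 hk3 => slotPatternPos_three_low k hk1 hk3) W hW hij hWij

/-- **`(3,4)` for quadruples containing the whole cube** (branching). [this work] -/
theorem patternForm_three_four_one_cons_nonneg (U : Fin 3 → Finset (Q 3 4)) (hU : ∀ j, IsUpperSet (U j : Set (Q 3 4))) :
    0 ≤ patternForm 3 4 (Fin.cons (fun _ => (1 : ℝ)) (fun j => setInd (U j))) :=
  patternForm_one_cons_nonneg (d := 3) (n := 2) slotPatternPos_three_three U hU

/-- **THE OPEN CELL `(3,4)` REDUCES TO ANTICHAINS**: positivity of the order-4 pattern functional on pairwise incomparable quadruples of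
up-sets of `[4]^3` implies `SlotPatternPos 3 4`. [this work] -/
theorem slotPatternPos_three_four_of_antichains
    (hanti : ∀ W : Fin 4 → Finset (Q 3 4), (∀ j, IsUpperSet (W j : Set (Q 3 4))) →
      (∀ i j, i ≠ j → ¬ W i ⊆ W j) → 0 ≤ patternForm 3 4 (fun k => setInd (W k))) :
    SlotPatternPos 3 4 :=
  slotPatternPos_of_antichains (d := 3) (n := 2) (fun k hk1 hk3 => slotPatternPos_three_low k hk1 hk3) hanti

/-- **THE SHARP FORM AT `(3,4)`**: `SlotPatternPos 3 4` follows from positivity on the quadruples of up-sets of `[4]^3` in which no member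
contains the intersection of the other three. [this work] -/
theorem slotPatternPos_three_four_of_noncontaining
    (hcore : ∀ W : Fin 4 → Finset (Q 3 4), (∀ j, IsUpperSet (W j : Set (Q 3 4))) →
      (∀ j, ∃ y, (∀ k, k ≠ j → y ∈ W k) ∧ y ∉ W j) → 0 ≤ patternForm 3 4 (fun k => setInd (W k))) :
    SlotPatternPos 3 4 :=
  slotPatternPos_of_noncontaining (d := 3) (n := 2) (fun k hk1 hk3 => slotPatternPos_three_low k hk1 hk3) hcore

/-- **Lieb–Sahi's first open cell follows from the non-containing core**: positivity of the order-4 pattern functional on the quadruples of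
up-sets of `[4]^3` in which no member contains the intersection of the other three implies `LiebSahiContinuum 3 4` (product measures on
`[0,1]^3`, `E_4 ≥ 0`) and Sahi positivity of order `4` for every product weight on every three-dimensional grid. [this work] -/
theorem liebSahiContinuum_three_four_of_noncontaining
    (hcore : ∀ W : Fin 4 → Finset (Q 3 4), (∀ j, IsUpperSet (W j : Set (Q 3 4))) →
      (∀ j, ∃ y, (∀ k, k ≠ j → y ∈ W k) ∧ y ∉ W j) → 0 ≤ patternForm 3 4 (fun k => setInd (W k))) :
    LiebSahiContinuum 3 4 :=
  liebSahiContinuum_of_slotPatternPos (slotPatternPos_three_four_of_noncontaining hcore)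

/-- **For cell `prim-sahi`'s census of `PatternPosN 4 3`**: it suffices to check `sStarN 4 3 A ≥ 0` on the quadruples of up-sets of `[4]^3` in which
no member contains the intersection of the other three. [this work] -/
theorem patternPosN_four_three_of_noncontaining
    (hcore : ∀ A : Fin 4 → Finset (Q 3 4), (∀ j, IsUpperSet (A j : Set (Q 3 4))) →
      (∀ j, ∃ y, (∀ k, k ≠ j → y ∈ A k) ∧ y ∉ A j) → 0 ≤ SahiGridPatternN.sStarN 4 3 A) :
    SahiGridPatternN.PatternPosN 4 3 := by
  refine patternPosN_iff_slotPatternPos.2 (slotPatternPos_three_four_of_noncontaining fun W hW hnc => ?_)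
  have h := hcore W hW hnc
  rw [← sStarN_cast_eq_patternForm (by norm_num) W]
  exact_mod_cast h

end SahiSlot

end Summit.CriticalPhenomena.PercolationContinuityZ3.Theorems
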